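import Summits.ValiantsHypothesis.ValiantsHypothesis.Theorems.RigidityForcesSymmetryRankRigidMinimalReprLaplaceResidualIndicatorFibre

/-!
# CASE 2 of the `a = 3` residual blueprint for `LaplaceOptimal 5`: a kernel-line covector `φ₁` inside any `V₁`
# (crux `RankRigidMinimalRepr`, stmt-ValiantsHypothesis-18034; frontier rung `LaplaceOptimalFive`, stmt-24813)

CASE 2 of val-lit-p8 g11's plan (`NOTE-p8g11-24813-a3-class-residual4.md` §v3): the slice at slot `0` is an indicator
`κ·e_a`, so the dual covector at slot `0` is (after STEP 0′) `φ₀ = 𝟙 − e_a` (`φ₀(a) = 0`, `φ₀ ≡ 1` off `a`), and the covector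
`φ₁` at slot `1` must lie in `V₁ = {φ₁ : Σ φ₁ β = 0, Σ φ₁ μ = 0}` (the slice kill at slot `1` and the pair kill charged at slot `1`)
AND make the kernel `{φ₂ : all fibre sums F(φ₀,φ₁,φ₂)(x,y), x ≠ y, vanish}` at most a LINE — the hypothesis `hline` of
val-port-2's reduction `exists_orthogonal_not_proportional` (memo `NOTE-port2-24813-a3-residual-bricks.md` (R1), interface agreed on
the val-lit bus 08:27Z).  THIS FILE: **`caseTwo_exists_phi1`** — for EVERY `a` and EVERY two covectors `β, μ` there are `φ₁ ∈ V₁` and a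
vector `w` with that kernel-line property for `φ₀ = 𝟙 − e_a`.  Proof = the memo's Case-2 case analysis made explicit (no dimension
count): a cross vector of `(β; μ)` on `{a, j, k}` with `φ₁(a) ≠ 0` (K1, `fibreSum_kernel_line_of_apply_ne_zero`) if some off-`a`
`2 × 2` minor of `(β; μ)` is non-zero; otherwise a two-letter vector `β_k e_j − β_j e_k` (or the `μ` analogue) with non-zero letter
sum (K2a, `fibreSum_kernel_line_of_two_letters`) unless `β` and `μ` are CONSTANT off `a`, in which case `e_b` (if both constants
vanish; K2a) or the balanced vector `e_b + e_c − e_d − e_e` (K2b, `fibreSum_kernel_zero_of_balanced`) lies in `V₁`.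
Also: `exists_four_others`, `indicator_orthogonal` (STEP 0′: `𝟙 − e_a ⊥ κ e_a`), and the separate-covector forms of the three
kernel lines.  No definitions.  Seat val-lit-p3 g14 (second hand under val-port-2's cut, val-lit desk RULINGS #260 (c) / #263 (c)).

HONEST FRAMING: elementary helper lemmas toward the frontier rung `LaplaceOptimalFive` (stmt-24813), which stays OPEN (as do
24814 / 18034); `hres` is NOT discharged here; nothing bears on `VP ≠ VNP`, which is NOT proved. [folklore]
-/

set_option autoImplicit false

-- the mandated summit-side namespace repeats a component by design (single-problem summit)
set_option linter.dupNamespace false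

namespace Summit.ValiantsHypothesis.ValiantsHypothesis.Theorems.RigidityForcesSymmetryRankRigidMinimalRepr

namespace LaplaceResidual

open Finset

/-! ### §1 Letters and the indicator complement -/

/-- Every letter of `Fin 5` has four pairwise distinct companions. [folklore] -/
theorem exists_four_others_fin5 : ∀ a : Fin 5, ∃ b c d e : Fin 5,
    b ≠ a ∧ c ≠ a ∧ d ≠ a ∧ e ≠ a ∧ b ≠ c ∧ b ≠ d ∧ b ≠ e ∧ c ≠ d ∧ c ≠ e ∧ d ≠ e := by
  decide

/-- **STEP 0′.**  The indicator complement `𝟙 − e_a` is orthogonal to every indicator slice `κ·e_a`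
(a vector vanishing off `a`). [folklore] -/
theorem indicator_orthogonal (a : Fin 5) (α : Fin 5 → ℂ) (hα : ∀ c, c ≠ a → α c = 0) :
    (∑ y, (fun x : Fin 5 => if x = a then (0 : ℂ) else 1) y * α y) = 0 := by
  refine Finset.sum_eq_zero fun y _ => ?_
  by_cases hy : y = a
  · simp [hy]
  · simp [hy, hα y hy]

/-! ### §2 The three kernel lines for separate covectors `φ₀, φ₁, φ₂` -/

/-- (K1) for separate covectors: `φ₀(a) = 0`, `φ₀ ≠ 0` off `a`, `φ₁(a) ≠ 0` ⇒ the fibre-sum kernel is the line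
`ℂ·((−φ₁ a) e_a + Σ_{x≠a} φ₁ x e_x)`. [folklore] -/
theorem hline_of_apply_ne_zero (φ₀ φ₁ : Fin 5 → ℂ) (a : Fin 5) (ha : φ₀ a = 0) (h0 : ∀ c, c ≠ a → φ₀ c ≠ 0)
    (h1 : φ₁ a ≠ 0) :
    ∀ φ₂ : Fin 5 → ℂ, (∀ x y : Fin 5, x ≠ y →
      (∑ τ : Equiv.Perm (Fin 5), if τ 3 = x ∧ τ 4 = y then φ₀ (τ 0) * φ₁ (τ 1) * φ₂ (τ 2) else 0) = 0) →
      ∃ κ : ℂ, ∀ c, φ₂ c = κ * (fun x => if x = a then -φ₁ a else φ₁ x) c :=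
  fun φ₂ hF => fibreSum_kernel_line_of_apply_ne_zero ![φ₀, φ₁, φ₂, φ₂, φ₂] a ha h0 h1 hF

/-- (K2a) for separate covectors. [folklore] -/
theorem hline_of_two_letters (φ₀ φ₁ : Fin 5 → ℂ) (a : Fin 5) (ha : φ₀ a = 0) (h0 : ∀ c, c ≠ a → φ₀ c ≠ 0)
    (b c : Fin 5) (hba : b ≠ a) (hca : c ≠ a) (hbc : b ≠ c)
    (h1a : φ₁ a = 0) (h1off : ∀ x, x ≠ b → x ≠ c → φ₁ x = 0) (hnd : φ₀ c * φ₁ b + φ₀ b * φ₁ c ≠ 0) :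
    ∀ φ₂ : Fin 5 → ℂ, (∀ x y : Fin 5, x ≠ y →
      (∑ τ : Equiv.Perm (Fin 5), if τ 3 = x ∧ τ 4 = y then φ₀ (τ 0) * φ₁ (τ 1) * φ₂ (τ 2) else 0) = 0) →
      ∃ κ : ℂ, ∀ x, φ₂ x = κ * (fun x => if x = b then φ₁ b else if x = c then -φ₁ c else 0) x :=
  fun φ₂ hF => fibreSum_kernel_line_of_two_letters ![φ₀, φ₁, φ₂, φ₂, φ₂] a ha h0 b c hba hca hbc h1a h1off hnd hF

/-- (K2b) for separate covectors (kernel `0 ⊆ ℂ·0`). [folklore] -/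
theorem hline_of_balanced (φ₀ φ₁ : Fin 5 → ℂ) (a b c d e : Fin 5) (ha : φ₀ a = 0) (h0 : ∀ x, x ≠ a → φ₀ x ≠ 0)
    (hba : b ≠ a) (hca : c ≠ a) (hda : d ≠ a) (hea : e ≠ a)
    (hbc : b ≠ c) (hbd : b ≠ d) (hbe : b ≠ e) (hcd : c ≠ d) (hce : c ≠ e) (hde : d ≠ e)
    (h1a : φ₁ a = 0) (h1b : φ₁ b = φ₀ b) (h1c : φ₁ c = φ₀ c) (h1d : φ₁ d = -φ₀ d) (h1e : φ₁ e = -φ₀ e) :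
    ∀ φ₂ : Fin 5 → ℂ, (∀ x y : Fin 5, x ≠ y →
      (∑ τ : Equiv.Perm (Fin 5), if τ 3 = x ∧ τ 4 = y then φ₀ (τ 0) * φ₁ (τ 1) * φ₂ (τ 2) else 0) = 0) →
      ∃ κ : ℂ, ∀ x, φ₂ x = κ * (0 : Fin 5 → ℂ) x :=
  fun φ₂ hF => fibreSum_kernel_line_of_balanced ![φ₀, φ₁, φ₂, φ₂, φ₂] a b c d e ha h0 hba hca hda hea hbc hbd hbe hcd hce
    hde h1a h1b h1c h1d h1e hF

/-! ### §3 A kernel-line covector in every `V₁` -/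

/-- **CASE 2: a good `φ₁` in every `V₁`.**  For every letter `a` and every two covectors `β, μ : Fin 5 → ℂ` there are
`φ₁` with `Σ φ₁ β = 0 = Σ φ₁ μ` and a vector `w` such that, for `φ₀ = 𝟙 − e_a`, every `φ₂` all of whose fibre sums
`F(φ₀,φ₁,φ₂)(x,y)`, `x ≠ y`, vanish is a multiple of `w` (the hypothesis `hline` of the image-dimension reduction). [folklore] -/
theorem caseTwo_exists_phi1 (a : Fin 5) (β μ : Fin 5 → ℂ) :
    ∃ φ₁ w : Fin 5 → ℂ, (∑ c, φ₁ c * β c) = 0 ∧ (∑ c, φ₁ c * μ c) = 0 ∧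
      ∀ φ₂ : Fin 5 → ℂ, (∀ x y : Fin 5, x ≠ y →
        (∑ τ : Equiv.Perm (Fin 5), if τ 3 = x ∧ τ 4 = y then
          (fun x : Fin 5 => if x = a then (0 : ℂ) else 1) (τ 0) * φ₁ (τ 1) * φ₂ (τ 2) else 0) = 0) →
        ∃ κ : ℂ, ∀ c, φ₂ c = κ * w c := by
  classical
  set φ₀ : Fin 5 → ℂ := fun x => if x = a then (0 : ℂ) else 1 with hφ₀
  have ha : φ₀ a = 0 := by simp [hφ₀]
  have h0 : ∀ c, c ≠ a → φ₀ c ≠ 0 := fun c hc => by simp [hφ₀, hc]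
  have h0' : ∀ c, c ≠ a → φ₀ c = 1 := fun c hc => by simp [hφ₀, hc]
  obtain ⟨b, c, d, e, hba, hca, hda, hea, hbc, hbd, hbe, hcd, hce, hde⟩ := exists_four_others_fin5 a
  -- every letter is one of `a, b, c, d, e`
  have hcover : ∀ x : Fin 5, x = a ∨ x = b ∨ x = c ∨ x = d ∨ x = e := by
    have hcard : ({a, b, c, d, e} : Finset (Fin 5)) = Finset.univ := by
      apply Finset.eq_univ_of_card
      rw [Finset.card_insert_of_notMem, Finset.card_insert_of_notMem, Finset.card_insert_of_notMem,
        Finset.card_insert_of_notMem, Finset.card_singleton]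
      · rfl
      · simpa using hde
      · simp [hcd, hce]
      · simp [hbc, hbd, hbe]
      · simp [hba.symm, hca.symm, hda.symm, hea.symm]
    intro x
    have hx : x ∈ ({a, b, c, d, e} : Finset (Fin 5)) := by rw [hcard]; exact Finset.mem_univ x
    simpa [Finset.mem_insert, Finset.mem_singleton] using hx
  -- sums over `Fin 5` as five terms
  have hsum5 : ∀ f : Fin 5 → ℂ, ∑ x, f x = f a + f b + f c + f d + f e := by
    intro f
    have huniv : (Finset.univ : Finset (Fin 5)) = {a, b, c, d, e} := by
      ext x; simpa [Finset.mem_insert, Finset.mem_singleton] using hcover x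
    rw [huniv, Finset.sum_insert (by simp [hba.symm, hca.symm, hda.symm, hea.symm]),
      Finset.sum_insert (by simp [hbc, hbd, hbe]), Finset.sum_insert (by simp [hcd, hce]),
      Finset.sum_pair hde]
    ring
  -- (A) some off-`a` minor of `(β; μ)` is non-zero: a cross vector with `φ₁ a ≠ 0`
  by_cases hA : ∃ j k : Fin 5, j ≠ a ∧ k ≠ a ∧ j ≠ k ∧ β j * μ k - β k * μ j ≠ 0
  · obtain ⟨j, k, hja, hka, hjk, hm⟩ := hA
    let φ₁ : Fin 5 → ℂ := fun x =>
      if x = a then β j * μ k - β k * μ j else if x = j then β k * μ a - β a * μ k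
      else if x = k then β a * μ j - β j * μ a else 0
    have hφa : φ₁ a = β j * μ k - β k * μ j := by simp [φ₁]
    have hφj : φ₁ j = β k * μ a - β a * μ k := by simp [φ₁, hja]
    have hφk : φ₁ k = β a * μ j - β j * μ a := by simp [φ₁, hka, hjk.symm]
    have hφ0 : ∀ x, x ≠ a → x ≠ j → x ≠ k → φ₁ x = 0 := fun x hxa hxj hxk => by simp [φ₁, hxa, hxj, hxk]
    -- the two orthogonality relations, as sums over `{a, j, k}`
    have hsum3 : ∀ f : Fin 5 → ℂ, (∀ x, x ≠ a → x ≠ j → x ≠ k → f x = 0) → ∑ x, f x = f a + f j + f k := by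
      intro f hf
      rw [← Finset.sum_subset (Finset.subset_univ ({a, j, k} : Finset (Fin 5)))]
      · rw [Finset.sum_insert (by simp [hja.symm, hka.symm]), Finset.sum_pair hjk]; ring
      · intro x _ hx
        simp only [Finset.mem_insert, Finset.mem_singleton, not_or] at hx
        exact hf x hx.1 hx.2.1 hx.2.2
    refine ⟨φ₁, fun x => if x = a then -φ₁ a else φ₁ x, ?_, ?_, ?_⟩
    · rw [hsum3 (fun x => φ₁ x * β x) (fun x hxa hxj hxk => by rw [hφ0 x hxa hxj hxk, zero_mul]), hφa, hφj, hφk]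
      ring
    · rw [hsum3 (fun x => φ₁ x * μ x) (fun x hxa hxj hxk => by rw [hφ0 x hxa hxj hxk, zero_mul]), hφa, hφj, hφk]
      ring
    · exact hline_of_apply_ne_zero φ₀ φ₁ a ha h0 (by rw [hφa]; exact hm)
  · push Not at hA
    -- all off-`a` minors vanish
    have hmin : ∀ j k : Fin 5, j ≠ a → k ≠ a → β j * μ k - β k * μ j = 0 := by
      intro j k hja hka
      by_cases hjk : j = k
      · rw [hjk]; ring
      · exact hA j k hja hka hjk
    -- (B) two off-`a` letters with different `β`-values: the two-letter vector `β_k e_j − β_j e_k`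
    by_cases hB : ∃ j k : Fin 5, j ≠ a ∧ k ≠ a ∧ j ≠ k ∧ β k - β j ≠ 0
    · obtain ⟨j, k, hja, hka, hjk, hne⟩ := hB
      let φ₁ : Fin 5 → ℂ := fun x => if x = j then β k else if x = k then -β j else 0
      have hφj : φ₁ j = β k := by simp [φ₁]
      have hφk : φ₁ k = -β j := by simp [φ₁, hjk.symm]
      have hφ0 : ∀ x, x ≠ j → x ≠ k → φ₁ x = 0 := fun x hxj hxk => by simp [φ₁, hxj, hxk]
      have hφa' : φ₁ a = 0 := hφ0 a hja.symm hka.symm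
      have hsum2 : ∀ f : Fin 5 → ℂ, (∀ x, x ≠ j → x ≠ k → f x = 0) → ∑ x, f x = f j + f k := by
        intro f hf
        rw [← Finset.sum_subset (Finset.subset_univ ({j, k} : Finset (Fin 5)))]
        · rw [Finset.sum_pair hjk]
        · intro x _ hx
          simp only [Finset.mem_insert, Finset.mem_singleton, not_or] at hx
          exact hf x hx.1 hx.2
      refine ⟨φ₁, fun x => if x = j then φ₁ j else if x = k then -φ₁ k else 0, ?_, ?_, ?_⟩
      · rw [hsum2 (fun x => φ₁ x * β x) (fun x hxj hxk => by rw [hφ0 x hxj hxk, zero_mul]), hφj, hφk]; ring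
      · rw [hsum2 (fun x => φ₁ x * μ x) (fun x hxj hxk => by rw [hφ0 x hxj hxk, zero_mul]), hφj, hφk]
        linear_combination -(hmin j k hja hka)
      · refine hline_of_two_letters φ₀ φ₁ a ha h0 j k hja hka hjk hφa' hφ0 ?_
        rw [h0' k hka, h0' j hja, hφj, hφk]
        intro h; apply hne; linear_combination h
    · push Not at hB
      have hβconst : ∀ j k : Fin 5, j ≠ a → k ≠ a → β k = β j := by
        intro j k hja hka
        by_cases hjk : j = k
        · rw [hjk]
        · have := hB j k hja hka hjk; exact (sub_eq_zero.1 this)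
      -- (C) two off-`a` letters with different `μ`-values (then `β ≡ 0` off `a`): the vector `μ_k e_j − μ_j e_k`
      by_cases hC : ∃ j k : Fin 5, j ≠ a ∧ k ≠ a ∧ j ≠ k ∧ μ k - μ j ≠ 0
      · obtain ⟨j, k, hja, hka, hjk, hne⟩ := hC
        -- `β` vanishes off `a`: `β j (μ k − μ j) = minor = 0`
        have hβ0 : ∀ x, x ≠ a → β x = 0 := by
          intro x hxa
          have h1 := hmin j k hja hka
          rw [hβconst j k hja hka] at h1
          have h2 : β j * (μ k - μ j) = 0 := by linear_combination h1
          have hβj : β j = 0 := (mul_eq_zero.1 h2).resolve_right hne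
          rw [hβconst j x hja hxa, hβj]
        let φ₁ : Fin 5 → ℂ := fun x => if x = j then μ k else if x = k then -μ j else 0
        have hφj : φ₁ j = μ k := by simp [φ₁]
        have hφk : φ₁ k = -μ j := by simp [φ₁, hjk.symm]
        have hφ0 : ∀ x, x ≠ j → x ≠ k → φ₁ x = 0 := fun x hxj hxk => by simp [φ₁, hxj, hxk]
        have hφa' : φ₁ a = 0 := hφ0 a hja.symm hka.symm
        have hsum2 : ∀ f : Fin 5 → ℂ, (∀ x, x ≠ j → x ≠ k → f x = 0) → ∑ x, f x = f j + f k := by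
          intro f hf
          rw [← Finset.sum_subset (Finset.subset_univ ({j, k} : Finset (Fin 5)))]
          · rw [Finset.sum_pair hjk]
          · intro x _ hx
            simp only [Finset.mem_insert, Finset.mem_singleton, not_or] at hx
            exact hf x hx.1 hx.2
        refine ⟨φ₁, fun x => if x = j then φ₁ j else if x = k then -φ₁ k else 0, ?_, ?_, ?_⟩
        · rw [hsum2 (fun x => φ₁ x * β x) (fun x hxj hxk => by rw [hφ0 x hxj hxk, zero_mul]), hφj, hφk,
            hβ0 j hja, hβ0 k hka]; ring
        · rw [hsum2 (fun x => φ₁ x * μ x) (fun x hxj hxk => by rw [hφ0 x hxj hxk, zero_mul]), hφj, hφk]; ring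
        · refine hline_of_two_letters φ₀ φ₁ a ha h0 j k hja hka hjk hφa' hφ0 ?_
          rw [h0' k hka, h0' j hja, hφj, hφk]
          intro h; apply hne; linear_combination h
      · push Not at hC
        have hμconst : ∀ j k : Fin 5, j ≠ a → k ≠ a → μ k = μ j := by
          intro j k hja hka
          by_cases hjk : j = k
          · rw [hjk]
          · have := hC j k hja hka hjk; exact (sub_eq_zero.1 this)
        -- `β` and `μ` are constant off `a`
        by_cases hD : β b = 0 ∧ μ b = 0
        · -- (D) both constants vanish: `e_b ∈ V₁`, a two-letter vector on `{b, c}` with letter sum `1`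
          have hβ0 : ∀ x, x ≠ a → β x = 0 := fun x hx => by rw [hβconst b x hba hx, hD.1]
          have hμ0 : ∀ x, x ≠ a → μ x = 0 := fun x hx => by rw [hμconst b x hba hx, hD.2]
          let φ₁ : Fin 5 → ℂ := fun x => if x = b then 1 else 0
          have hφb : φ₁ b = 1 := by simp [φ₁]
          have hφ0 : ∀ x, x ≠ b → φ₁ x = 0 := fun x hxb => by simp [φ₁, hxb]
          have hsum1 : ∀ f : Fin 5 → ℂ, (∀ x, x ≠ b → f x = 0) → ∑ x, f x = f b := by
            intro f hf
            rw [Finset.sum_eq_single b (fun x _ hx => hf x hx) (fun h => absurd (Finset.mem_univ b) h)]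
          refine ⟨φ₁, fun x => if x = b then φ₁ b else if x = c then -φ₁ c else 0, ?_, ?_, ?_⟩
          · rw [hsum1 (fun x => φ₁ x * β x) (fun x hxb => by rw [hφ0 x hxb, zero_mul]), hβ0 b hba, mul_zero]
          · rw [hsum1 (fun x => φ₁ x * μ x) (fun x hxb => by rw [hφ0 x hxb, zero_mul]), hμ0 b hba, mul_zero]
          · refine hline_of_two_letters φ₀ φ₁ a ha h0 b c hba hca hbc (hφ0 a hba.symm) (fun x hxb _ => hφ0 x hxb) ?_
            rw [h0' c hca, h0' b hba, hφb, hφ0 c hbc.symm]; norm_num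
        · -- (E) a non-zero constant: the balanced vector `e_b + e_c − e_d − e_e ∈ V₁`
          let φ₁ : Fin 5 → ℂ := fun x => if x = a then 0 else if x = d then -1 else if x = e then -1 else 1
          have hφa' : φ₁ a = 0 := by simp [φ₁]
          have hφb : φ₁ b = 1 := by simp [φ₁, hba, hbd, hbe]
          have hφc : φ₁ c = 1 := by simp [φ₁, hca, hcd, hce]
          have hφd : φ₁ d = -1 := by simp [φ₁, hda]
          have hφe : φ₁ e = -1 := by simp [φ₁, hea, hde.symm]
          refine ⟨φ₁, 0, ?_, ?_, ?_⟩
          · rw [hsum5, hφa', hφb, hφc, hφd, hφe, hβconst b c hba hca, hβconst b d hba hda, hβconst b e hba hea]; ring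
          · rw [hsum5, hφa', hφb, hφc, hφd, hφe, hμconst b c hba hca, hμconst b d hba hda, hμconst b e hba hea]; ring
          · exact hline_of_balanced φ₀ φ₁ a b c d e ha h0 hba hca hda hea hbc hbd hbe hcd hce hde hφa'
              (by rw [hφb, h0' b hba]) (by rw [hφc, h0' c hca]) (by rw [hφd, h0' d hda]) (by rw [hφe, h0' e hea])

end LaplaceResidual

end Summit.ValiantsHypothesis.ValiantsHypothesis.Theorems.RigidityForcesSymmetryRankRigidMinimalRepr
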